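import Literature.NumberTheory.EllipticCurves.OrdinaryNewformDatumSelfDualTwist
import Literature.NumberTheory.EllipticCurves.Castella2018.ErratumThm23UpperDivisibility
import HarnessLib

/-!
# Castella's erratum, Theorem 2.3, the «⊂» half (2.5) ON THE SELF-DUAL TATE TWIST — the corrected transcription (flag `T23-twist`)
# of `ErratumThm23UpperDivisibility.lean` (F4♯), for ONE `p`-ordinary crystalline newform `g` over `K`, read in `𝓞_{ℂ_p}⟦T⟧`

Cell `bsd-stepL`, seat `bsd-stepL-imc-p1` g24 (2026-08-28; memo `run/shared/lean/pub/bsd-stepL/imc-p1/g24/TWIST-AUDIT-25505-imc-p1-g24.md`,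
evidence on items stmt-BirchSwinnertonDyer-25505 ∕ 20169 ∕ 19061; director-bsd relay 2026-08-28T18:38Z: the same defect returned by the
UTD vet on item 27934, repair (R1)/(R2) requested importable by both cells). ONE new OPEN claim-tagged `Prop` (D-0014: +1 unproved) —
TWIST AUDIT repair (R2): the corrected transcription that crux 25505 `ErratumThm23SigmaLe` is meant to be re-keyed to (planner ruling);
F4♯ is left untouched for its consumers of record. Vocabulary: `OrdinaryNewformDatumSelfDualTwist.lean` (`Δ.selfDualRep`,
`Δ.selfDualCofreeRepOver K`).

## What changes with respect to F4♯, and why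

F4♯ (`Castella2018.erratumThm23_charIdeal_sigma_le_of_isTorsion_OPEN`, imc-p1 g15) transcribed the erratum's (2.5) with the Galois module
`XBig κ (Δ.cofreeRepOver K) 𝔭bar Σ`, i.e. with the datum's UNTWISTED lattice `Δ.ρ` (`OrdinaryNewformDatum.charpoly`: arithmetic-Frobenius
characteristic polynomial `X² − ι(a_ℓ)X + ℓ^{k−1}`, `det Δ.ρ = ε^{k−1}`). The erratum (§2, p. 2, VERBATIM): «Let `V_g` be the self-dual Tate
twist of the Galois representation associated to `g` by Deligne, let `T_g ⊂ V_g` be the `G_ℚ`-stable `𝒪`-lattice in [Nek92, § 3], and put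
`A_g := V_g/T_g`» (`det T_g = ε`; [CH18] §1 «`V_f(r)` the self-dual Tate twist», §7.1 pairing `T × T → 𝒪(1)`; [FW21] p. 6 «`V = M(f)(k/2)`»).
The two modules coincide iff `k = 2`; the cell's consumers (K2 Road FF) instantiate F4♯ only at Hida members of weight `k > 2`. The `L`-side
`IsBDPLFunctionWtSigmaInt` interpolates CENTRAL values `L^Σ(g/K, φ, k/2)` (∞-type `(n,−n)`, `n ≥ k/2`; [CH18 Prop. 3.8]) — the self-dual line —
while the (𝔭-relaxed, 𝔭̄-strict) Selmer dual of the untwisted module is governed by the EDGE line (`L(g/K, φ, k−1)`, `n ≥ k−1`). This file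
states (2.5) for the self-dual module `Δ.selfDualCofreeRepOver K` (`Δ.selfDualRep = Δ.ρ ⊗ ε^{1−k/2}`), every other binder BYTE-IDENTICAL with
F4♯ (flags `T23-compat`, `T23-p`, `T23-footnote`, `T23-receptacle`, `T23-frame-∀`, `T23-sigma-interp`, `T23-torsion-premise`, `T23-one-sided`,
`T23-top` as documented there; (i′) residual irreducibility ∕ ramification at `q ∥ M`, `q ≠ p`, are insensitive to a twist by a power of `ε`,
which is unramified away from `p` and trivial residually up to `ω^{1−k/2}`, so they are kept on `Δ`).
STATUS: **OPEN ∕ PRE** exactly as F4♯ (rests on [FouquetWan2021, Thm. 4.41] + App. B Cor. 7.21 ∕ L. 7.22, the weight-`k` analogue of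
[CGS25 Prop. 2.4.5], [JSW17 Cor. 3.4.2], [Hsi14 Thm. B]; the erratum is unrefereed). NEVER cite this `Prop` as a theorem.

## References

* [Castella2018Erratum] §2 (p. 2: the self-dual Tate twist, `T_g`, `A_g`, `M_g`), Thm. 2.3, (2.4)–(2.5), footnote 1 (pp. 3–4).
* [CastellaHsieh2018] Math. Ann. 370, §1 (p. 1), §3.3 Prop. 3.8, §7.1 ((7.1)). [Nekovar1992] §3. [FouquetWan2021] Thm. 4.41 (PREPRINT).
* [JetchevSkinnerWan2017] Cor. 3.4.2, §5.1. [Castella2018] Def. 2.2, Thm. 3.1, (3.1). Tree: `OrdinaryNewformDatumSelfDualTwist.lean`,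
  `Castella2018/ErratumThm23UpperDivisibility.lean` (F4♯), `BDPAnticyclotomicPAdicLFunctionSigmaInt.lean`, `BigGaloisRepSelmer.lean`.
-/

noncomputable section

open scoped Classical

namespace Literature.NumberTheory.EllipticCurves.Castella2018

open PowerSeries NumberField IsDedekindDomain Field
  Literature.NumberTheory.EllipticCurves Literature.NumberTheory.EllipticCurves.ModularForms
  Literature.NumberTheory.EllipticCurves.BigGaloisRep Literature.NumberTheory.EllipticCurves.GreenbergSelmer
  Literature.NumberTheory.GaloisRepresentations

/-- **OPEN HYPOTHESIS — Castella's erratum, Thm. 2.3, the «⊂» half (2.5), Σ-imprimitive, for ONE `p`-ordinary crystalline newform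
`g ∈ S_k(Γ₀(M))` over `K`, ON THE SELF-DUAL TATE TWIST `A_g = V_g^†/T_g^†`, read in `𝓞_{ℂ_p}⟦T⟧:
`Ch_{Λ_𝒪}(X^Σ_ac(A_g))·𝓞_{ℂ_p}⟦T⟧ ⊆ (L^Σ_p(g))` for every Σ-imprimitive frame `L^Σ_p(g) = Q` of `g`, under the torsion premise** —
the erratum's use of [FW21, Thm. 4.41] (UNREFEREED), isolated from the member package. BYTE-IDENTICAL with
`erratumThm23_charIdeal_sigma_le_of_isTorsion_OPEN` (F4♯; binders, transcription and flags `T23-compat`, `T23-p`, `T23-footnote`,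
`T23-receptacle`, `T23-frame-∀`, `T23-sigma-interp`, `T23-torsion-premise`, `T23-one-sided`, `T23-top` as in that file's module
docstring) EXCEPT for the Galois module, which is here the erratum's own: §2 (p. 2) «Let `V_g` be the self-dual Tate twist of the Galois
representation associated to `g` by Deligne, let `T_g ⊂ V_g` be the `G_ℚ`-stable `𝒪`-lattice in [Nek92, § 3], and put `A_g := V_g/T_g`» —
the tree's `Δ.selfDualCofreeRepOver K` (lattice `Δ.selfDualRep = Δ.ρ ⊗ ε^{1−k/2}`, `det = ε`; file `OrdinaryNewformDatumSelfDualTwist`),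
NOT the untwisted `Δ.cofreeRepOver K` (`det Δ.ρ = ε^{k−1}`) of F4♯, which agrees with it only at `k = 2`
(`OrdinaryNewformDatum.selfDualRep_eq_of_two`); the `L`-side `IsBDPLFunctionWtSigmaInt` interpolates the CENTRAL values
`L^Σ(g/K, φ, k/2)` [CH18 Prop. 3.8], i.e. the self-dual line (cell bsd-stepL memo `imc-p1/g24/TWIST-AUDIT-25505-imc-p1-g24.md`).
Flag `T23-twist`: F4♯ is superseded by this `Prop` at every `k > 2`. NEVER cite this `Prop` as a theorem: take it as an explicit
hypothesis; a result using it is conditional on unrefereed claims.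
-- TODO(general form): (i) as printed is «ρ̄_g|_{G_K} irreducible»; the receptacle in print is `Λ_𝒪^ur = Λ_{R₀} ⊗_{ℤ_p} 𝒪`.
[claim: Castella2018Erratum, status: under-review]
[claim: FouquetWan2021, status: under-review]
[cite: JetchevSkinnerWan2017, Cor. 3.4.2, proof of Thm. 6.1.6 and §5.1 (the inputs of (2.4) ⇒ (2.5) and the Σ-imprimitive interpolation; shape)]
[cite: Castella2018, Def. 2.2, Thm. 3.1 and (3.1) (p. 9) (the objects `X^Σ_ac`, `L^Σ_p`; shape only, nothing asserted)]
[cite: CastellaHsieh2018, §1 (p. 1) and §7.1 (the self-dual lattice `T ⊂ V_f(r)` with its pairing `T × T → 𝒪(1)`)] -/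
def erratumThm23_charIdeal_sigma_le_of_isTorsion_selfDual_OPEN : Prop :=
  ∀ {p : ℕ} [Fact p.Prime] (ι : PadicAlgCl p ≃+* ℂ) {M : ℕ} [NeZero M] {k : ℤ}
    (g : CuspForm (CongruenceSubgroup.Gamma0 M) k) (ιg : coeffField g →+* PadicAlgCl p)
    (Δ : OrdinaryNewformDatum g p ιg)
    (K : Type) [Field K] [NumberField K] (𝔭 𝔭bar : HeightOneSpectrum (𝓞 K)) (κ : ZpExtension K p)
    (γ : absoluteGaloisGroup K) [Fact (κ.IsTopGenerator γ)] (S : Finset (HeightOneSpectrum (𝓞 K))),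
    -- "`g ∈ S_k(Γ₀(M))` a `p`-ordinary newform of (even) weight `k ≥ 2` and level `M ≥ 3` with `p ∤ M`"; ADDED: `p > 3` (flag `T23-p`)
    IsNewform0 g → 2 ≤ k → Even k → 3 ≤ M → ¬ p ∣ M → 3 < p →
    -- ONE embedding `ı_p` fixed once (§2, p. 2): the coefficient embedding `ι_g` IS `ι⁻¹` on `ℚ(g) ⊂ ℂ` (flag `T23-compat`), `g` is `ı_p`-ordinary
    (∀ x : coeffField g, ι (ιg x) = (x : ℂ)) →
    ‖ιg ⟨(UpperHalfPlane.qExpansion 1 ⇑g).coeff p, coeff_mem_coeffField g p⟩‖ = 1 →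
    -- `K` imaginary quadratic, Heegner for `M`, `p` split, `𝔭` via `ι`, `𝔭bar ≠ 𝔭` the other prime above `p` (flag `T23-orient`)
    IsImaginaryQuadratic K → (∃ β : ℤ, (4 * M : ℤ) ∣ β ^ 2 - NumberField.discr K) →
    ((Ideal.span {(p : ℤ)}).primesOver (𝓞 K)).ncard = 2 →
    ((p : ℕ) : 𝓞 K) ∈ 𝔭.asIdeal →
    (∀ (w : InfinitePlace K) (x : 𝓞 K), x ∈ 𝔭.asIdeal ↔ ‖ι.symm (w.embedding (x : K))‖ < 1) →
    ((p : ℕ) : 𝓞 K) ∈ 𝔭bar.asIdeal → 𝔭bar ≠ 𝔭 →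
    -- (i′) `ρ̄_g` irreducible and ramified at some prime `q ∥ M` non-split in `K` (footnote 1 ⟹ (i); flag `T23-footnote`);
    -- residual irreducibility / ramification away from `p` are insensitive to the twist by a power of `ε` (unramified away from `p`)
    SkinnerUrban2014.IsResiduallyIrreducible Δ →
    (∃ v : HeightOneSpectrum (𝓞 ℚ), SkinnerUrban2014.IsResiduallyRamifiedAt Δ v ∧
      ((Rat.HeightOneSpectrum.primesEquiv v : Nat.Primes) : ℕ) ∣ M ∧
      ¬ ((Rat.HeightOneSpectrum.primesEquiv v : Nat.Primes) : ℕ) ^ 2 ∣ M ∧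
      ((Ideal.span {(((Rat.HeightOneSpectrum.primesEquiv v : Nat.Primes) : ℕ) : ℤ)}).primesOver (𝓞 K)).ncard ≠ 2) →
    -- (ii) "if `2` is nonsplit in `K`, then `2 ∥ M`"
    (((Ideal.span {(2 : ℤ)}).primesOver (𝓞 K)).ncard ≠ 2 → (2 ∣ M ∧ ¬ 4 ∣ M)) →
    -- (iii)+(iv) every `ℓ ∣ M` non-split in `K`: `ℓ ∥ M` and `π(g)_ℓ` special ⊗ (`ℓ ↦ −ℓ^{k/2−1}`), i.e. `a_ℓ(g) = −ℓ^{k/2−1}`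
    (∀ ℓ : ℕ, ℓ.Prime → ℓ ∣ M → ((Ideal.span {(ℓ : ℤ)}).primesOver (𝓞 K)).ncard ≠ 2 →
      ¬ ℓ ^ 2 ∣ M ∧ (UpperHalfPlane.qExpansion 1 ⇑g).coeff ℓ = -((ℓ : ℂ) ^ (k / 2 - 1).toNat)) →
    -- `Γ` THE anticyclotomic `ℤ_p`-extension; `Σ` finite, away from `p`, containing the primes dividing `M`
    κ.IsAnticyclotomic → (∀ w ∈ S, ((p : ℕ) : 𝓞 K) ∉ w.asIdeal) →
    (∀ w : HeightOneSpectrum (𝓞 K), ((M : ℕ) : 𝓞 K) ∈ w.asIdeal → w ∈ S) →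
    -- the inclusion `b : 𝒪 → 𝓞_{ℂ_p}` (characterised) and a Σ-imprimitive frame `(Ω_K, Ω_p, Q)` of `g` in `𝓞_{ℂ_p}⟦T⟧`
    ∀ (b : padicCoeffIntegers ιg →+* PadicComplexInt p),
      (∀ x, ((b x : PadicComplexInt p) : ℂ_[p]) =
        algebraMap (PadicAlgCl p) ℂ_[p] (padicCoeffIntegers.toPadicAlgCl ιg x)) →
    ∀ (ΩK : ℂ) (Ωp : (PadicComplexInt p)ˣ) (Q : PowerSeries (PadicComplexInt p)), ΩK ≠ 0 →
      IsBDPLFunctionWtSigmaInt ι 𝔭 κ γ g S ΩK ((Ωp : PadicComplexInt p) : ℂ_[p]) Q →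
      ∀ [TopologicalSpace (PowerSeries (padicCoeffIntegers ιg))]
        [ContinuousSMul (PowerSeries (padicCoeffIntegers ιg))
          (BigRepModule (padicCoeffIntegers ιg) p (Cofree Δ.selfDualRep (padicCoeffField ιg)))],
      -- premise (R-f): `X^Σ_ac(A_g)` (SELF-DUAL `A_g`) is `Λ_𝒪`-torsion; conclusion (2.5): `Ch_{Λ_𝒪}(X^Σ_ac(A_g))·𝓞_{ℂ_p}⟦T⟧ ⊆ (Q)`
      Module.IsTorsion (PowerSeries (padicCoeffIntegers ιg)) (XBig κ (Δ.selfDualCofreeRepOver K) 𝔭bar (↑S)) →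
      (XBig.charIdeal κ (Δ.selfDualCofreeRepOver K) 𝔭bar (↑S)).map (PowerSeries.map b) ≤ Ideal.span {Q}

end Literature.NumberTheory.EllipticCurves.Castella2018

end
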